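import Mathlib
import HarnessLib
import Literature.Analysis.FluidPDE.VectorCalculus
import Literature.Analysis.FluidPDE.PressurePoisson
import Literature.Analysis.FluidPDE.LerayProfileCalculus
import Literature.Analysis.FluidPDE.TaoEnstrophyLocalisationProofs
import Literature.Analysis.FluidPDE.HarmonicLiouvilleLp
import Literature.Analysis.FluidPDE.TypeIAncientMildClassical
import Summits.NavierStokesRegularity.NavierStokesRegularity.Theorems.LocalTraceTubeDoorHarmonicOscillation
import Summits.NavierStokesRegularity.NavierStokesRegularity.Theorems.LocalTraceTubeDoorHarmonicHead
import Summits.NavierStokesRegularity.NavierStokesRegularity.Theorems.LocalTraceTubeDoorProfileRigidity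
import Summits.NavierStokesRegularity.NavierStokesRegularity.Theorems.LocalSineTubeDoorProfileAlignedWindowRigidityAncient
import Summits.NavierStokesRegularity.NavierStokesRegularity.Theorems.PoloidalWindowDoorPoloidalWindowRigidityWindow
import Summits.NavierStokesRegularity.NavierStokesRegularity.Theorems.PoloidalWindowDoorPoloidalWindowRigidityFlat
import Summits.NavierStokesRegularity.NavierStokesRegularity.Theorems.PoloidalWindowDoorPoloidalWindowRigidityPressureOscillation
import Summits.NavierStokesRegularity.NavierStokesRegularity.Theorems.LocalSineTubeDoorBoundedSubsolutionMaxPrinciple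

/-!
# The one-window door family — the ONE-PARAMETER HEAD FAMILY `Π_λ = p + λ|u|²/2`, `λ ∈ ℝ`:
# Type-I profiles on which `Π_λ` is harmonic on a window of every slice are trivial (all `λ` at once)

Cell ns-regularity-ideate, seat p6 (route-directed support for nsreg-p1's door family; bears_on LADDER-NS N0; anchor
`--supports stmt-NavierStokesRegularity-20018`, the profile-rigidity item of the family).  Door S14
(`…LocalTraceTubeDoorProfileRigidity`, `λ = 0`: harmonic PRESSURE) and the harmonic-head door (`…HarmonicHead`, `λ = 1`:
harmonic BERNOULLI HEAD) are the two ends of a one-parameter family: for a classical solution `(u, p)`,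
`ΔΠ_λ = Δ(p + λ|u|²/2) = (λ−1)·tr((Du)²) + λ·(⟪u, Δu⟫ + |curl u|²)` (`laplacian_headFamily_eq`; pressure Poisson,
`Δ|u|² = 2⟪Δu,u⟫ + 2|Du|²_F`, `|Du|²_F = |curl u|² + tr((Du)²)`), a pressure-free second-order scalar.  For EVERY real
`λ`, a profile `v` of the family's Type-I class (rate, continuity, unit-viscosity Oseen–Duhamel identity,
divergence-free slices) with this scalar vanishing on a nonempty open window of every slice `s < 0` is trivial:

(1) window → slab by slice analyticity (`headFamilySourceWindowToSlab`); (2) `Π_λ(s)` is harmonic with mean oscillation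
`≤ (K + |λ|/2)·C²/(−s)·|B̄|` on balls of radius `≥ 1` ((F1) `exists_integral_abs_sub_le_class` + the rate), hence
`∇Π_λ ≡ 0` (`fderiv_headFamily_eq_zero`, via `…HarmonicOscillation.fderiv_eq_zero_of_harmonic_of_oscillation`);
(3) then `−2⟪v, ∇p⟫ = λ (v·∇)|v|²`, so the energy balance reads `∂ₜq + (1−λ)(v·∇)q − Δq = −2|Dv|²_F ≤ 0`, `q = |v|²`:
a bounded sub-solution with the bounded drift `(1−λ)v` (`energy_subsolution_of_headFamily`), and the whole-space
maximum principle with the Type-I rate gives `v ≡ 0` (`eq_zero_of_headFamily`); (4) `headFamilyWindowRigidity` is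
the door-crux form.  The DOOR for `λ ≠ 0` is second order (sequel `…HeadFamilyTarget`); `λ = 0` is S14.

WHAT THIS IS NOT: not a claim about Navier–Stokes regularity (Clay A) — a one-parameter family of settled strata /
profile cruxes of local regularity CRITERIA conditional on local Type I («for every λ, Type-I blow-up needs
Δ(p + λ|u|²/2) ≢ 0 on every similarity window»); establishment in the cell's sense still requires the cross-family
referee PASS + independent reproduction.
-/

noncomputable section

-- the summit and its single sub-problem share the name (CONVENTIONS §1), as in every Theorems file
set_option linter.dupNamespace false

namespace Summit.NavierStokesRegularity.NavierStokesRegularity.Theorems.LocalTraceTubeDoorHeadFamily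

open MeasureTheory Set Function Filter Topology TopologicalSpace Metric InnerProductSpace
open scoped RealInnerProductSpace InnerProductSpace Laplacian ContDiff
open Literature.Analysis Literature.Analysis.FluidPDE
open Summit.NavierStokesRegularity.NavierStokesRegularity.Theorems.LocalTraceTubeDoorHarmonicOscillation
open Summit.NavierStokesRegularity.NavierStokesRegularity.Theorems.LocalTraceTubeDoorHarmonicHead
open Summit.NavierStokesRegularity.NavierStokesRegularity.Theorems.LocalTraceTubeDoorProfileRigidity
open Summit.NavierStokesRegularity.NavierStokesRegularity.Theorems.LocalSineTubeDoorProfileAlignedWindowRigidityAncient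
open Summit.NavierStokesRegularity.NavierStokesRegularity.Theorems.PoloidalWindowDoorPoloidalWindowRigidityWindow
open Summit.NavierStokesRegularity.NavierStokesRegularity.Theorems.PoloidalWindowDoorPoloidalWindowRigidityFlat
open Summit.NavierStokesRegularity.NavierStokesRegularity.Theorems.PoloidalWindowDoorPoloidalWindowRigidityPressureOscillation
open Summit.NavierStokesRegularity.NavierStokesRegularity.Theorems.LocalSineTubeDoorBoundedSubsolutionMaxPrinciple

/-! ### the Laplacian of `Π_λ = p + λ|u|²/2` -/

/-- **`Δ(p + λ|u|²/2) = (λ−1) tr((Du)²) + λ (⟪u, Δu⟫ + |curl u|²)`** for a classical solution `(u, p)` of the unforced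
Navier–Stokes system on an open time set (any viscosity, any real `λ`). -/
theorem laplacian_headFamily_eq {S : Set ℝ} (hSo : IsOpen S) {ν : ℝ} (lam : ℝ)
    {u : ℝ → EuclideanSpace ℝ (Fin 3) → EuclideanSpace ℝ (Fin 3)} {p : ℝ → EuclideanSpace ℝ (Fin 3) → ℝ}
    (hns : IsClassicalNSSolutionOn S ν 0 u p) {t : ℝ} (ht : t ∈ S) (x : EuclideanSpace ℝ (Fin 3)) :
    (Δ (fun y => p t y + lam / 2 * ⟪u t y, u t y⟫_ℝ)) x =
      (lam - 1) * LinearMap.trace ℝ (EuclideanSpace ℝ (Fin 3))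
          (((fderiv ℝ (u t) x).comp (fderiv ℝ (u t) x)) : EuclideanSpace ℝ (Fin 3) →ₗ[ℝ] EuclideanSpace ℝ (Fin 3)) +
        lam * (⟪u t x, (Δ (u t)) x⟫_ℝ + ‖curl (u t) x‖ ^ 2) := by
  have htI : t ∈ interior S := by rw [hSo.interior_eq]; exact ht
  have hu2 : ContDiff ℝ 2 (u t) := contDiff_infty.1 (hns.contDiff_velocity ht) 2
  have hp2 : ContDiff ℝ 2 (p t) := contDiff_infty.1 (hns.contDiff_pressure ht) 2
  have hq2 : ContDiff ℝ 2 (fun y => ⟪u t y, u t y⟫_ℝ) := hu2.inner ℝ hu2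
  have hq2' : ContDiff ℝ 2 (fun y => lam / 2 * ⟪u t y, u t y⟫_ℝ) := contDiff_const.mul hq2
  have hadd : (Δ (fun y => p t y + lam / 2 * ⟪u t y, u t y⟫_ℝ)) x =
      (Δ (p t)) x + (Δ (fun y => lam / 2 * ⟪u t y, u t y⟫_ℝ)) x := by
    have e : (fun y => p t y + lam / 2 * ⟪u t y, u t y⟫_ℝ) = (p t) + fun y => lam / 2 * ⟪u t y, u t y⟫_ℝ := rfl
    rw [e, (hp2.contDiffAt).laplacian_add hq2'.contDiffAt]
  have hsm : (Δ (fun y => lam / 2 * ⟪u t y, u t y⟫_ℝ)) x = lam / 2 * (Δ (fun y => ⟪u t y, u t y⟫_ℝ)) x := by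
    have e : (fun y => lam / 2 * ⟪u t y, u t y⟫_ℝ) = (lam / 2) • fun y => ⟪u t y, u t y⟫_ℝ := by
      funext y; simp [smul_eq_mul]
    rw [e, InnerProductSpace.laplacian_smul _ hq2.contDiffAt, smul_eq_mul]
  have hP : (Δ (p t)) x = -traceCLM ((fderiv ℝ (u t) x).comp (fderiv ℝ (u t) x)) := by
    rw [laplacian_pressure_eq_of_isClassicalNSSolutionOn hns htI x,
      divergence_convect_self_eq hu2 (hns.divFree t ht) x]
    have h0 : VectorCalculus.divergence ((0 : ℝ → EuclideanSpace ℝ (Fin 3) → EuclideanSpace ℝ (Fin 3)) t) x = 0 := by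
      rw [divergence_eq_traceCLM]; simp
    rw [h0, add_zero]
  have hL : (Δ (fun y => ⟪u t y, u t y⟫_ℝ)) x =
      2 * ⟪(Δ (u t)) x, u t x⟫_ℝ + 2 * frobeniusNormSq (fderiv ℝ (u t) x) := laplacian_inner_self_eq hu2 x
  have hF := frobeniusNormSq_fderiv_eq_sq_norm_curl_add_trace (u t) x
  rw [hadd, hsm, hP, hL, hF, real_inner_comm (u t x), ← traceCLM_apply]
  ring

/-! ### the class: profiles with harmonic `Π_λ` -/

variable {C : ℝ} {v : ℝ → EuclideanSpace ℝ (Fin 3) → EuclideanSpace ℝ (Fin 3)}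

/-- **`∇Π_λ(s) ≡ 0` on a slice where the source vanishes**: for a profile of the Type-I class, any window pressure
and any real `λ`, if `(λ−1) tr((Dv(s))²) + λ(⟪v(s), Δv(s)⟫ + |curl v(s)|²) ≡ 0` on the slice `s`, then the `C²`
function `Π_λ(s) = p(s) + λ|v(s)|²/2` is harmonic with mean oscillation `≤ (K + |λ|/2)·C²/(−s)·|B̄(y, r)|` on every ball
of radius `r ≥ 1`, hence has vanishing gradient. -/
theorem fderiv_headFamily_eq_zero (hrate : HasTypeITimeDecay C v)
    (hmild : ∀ s t : ℝ, s < t → t < 0 → ∀ x,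
      v t x = UnboundedOperators.heatExtension (v s) (t - s) x - oseenDuhamel 1 s v v t x)
    (lam : ℝ) {t₀ : ℝ} (ht₀ : t₀ < 0) {p : ℝ → EuclideanSpace ℝ (Fin 3) → ℝ}
    (hcl : IsClassicalNSSolutionOn (Ioo t₀ 0) 1 0 v p) {s : ℝ} (hs : s ∈ Ioo t₀ 0)
    (hH : ∀ y : EuclideanSpace ℝ (Fin 3),
      (lam - 1) * LinearMap.trace ℝ (EuclideanSpace ℝ (Fin 3))
          (((fderiv ℝ (v s) y).comp (fderiv ℝ (v s) y)) : EuclideanSpace ℝ (Fin 3) →ₗ[ℝ] EuclideanSpace ℝ (Fin 3)) +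
        lam * (⟪v s y, (Δ (v s)) y⟫_ℝ + ‖curl (v s) y‖ ^ 2) = 0)
    (y : EuclideanSpace ℝ (Fin 3)) :
    fderiv ℝ (fun z => p s z + lam / 2 * ⟪v s z, v s z⟫_ℝ) y = 0 := by
  have hs0 : 0 < -s := by linarith [hs.2]
  have hv2 : ContDiff ℝ 2 (v s) := contDiff_infty.1 (hcl.contDiff_velocity hs) 2
  have hp2 : ContDiff ℝ 2 (p s) := contDiff_infty.1 (hcl.contDiff_pressure hs) 2
  have hHead2 : ContDiff ℝ 2 (fun z => p s z + lam / 2 * ⟪v s z, v s z⟫_ℝ) :=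
    hp2.add (contDiff_const.mul (hv2.inner ℝ hv2))
  have hharm : HarmonicOnNhd (fun z => p s z + lam / 2 * ⟪v s z, v s z⟫_ℝ) univ :=
    harmonicOnNhd_of_laplacian_eq_zero hHead2 fun x => by rw [laplacian_headFamily_eq isOpen_Ioo lam hcl hs x, hH x]
  obtain ⟨K, hK0, hF1⟩ := exists_integral_abs_sub_le_class
  have hC2 : 0 ≤ C ^ 2 / (-s) := div_nonneg (sq_nonneg C) hs0.le
  set M : ℝ := (K + |lam| / 2) * (C ^ 2 / (-s)) with hM
  have hM0 : 0 ≤ M := mul_nonneg (by positivity) hC2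
  have hqbd : ∀ z, |lam / 2 * ⟪v s z, v s z⟫_ℝ| ≤ |lam| / 2 * (C ^ 2 / (-s)) := fun z => by
    rw [abs_mul, abs_div, abs_two, abs_of_nonneg (real_inner_self_nonneg (x := v s z))]
    refine mul_le_mul_of_nonneg_left ?_ (by positivity)
    rw [real_inner_self_eq_norm_sq]
    have h1 := hrate s hs.2 z
    have h2 : ‖v s z‖ ^ 2 ≤ (C / Real.sqrt (-s)) ^ 2 := pow_le_pow_left₀ (norm_nonneg _) h1 2
    rwa [div_pow, Real.sq_sqrt hs0.le] at h2
  have hosc : ∀ r : ℝ, 1 ≤ r → ∃ κ : ℝ, ∫ w in closedBall y r,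
      |(p s w + lam / 2 * ⟪v s w, v s w⟫_ℝ) - κ| ≤ M * volume.real (closedBall y r) := by
    intro r hr
    obtain ⟨κ, hκ⟩ := hF1 hrate hmild ht₀ hcl s hs y r hr
    refine ⟨κ, ?_⟩
    have hcomp : IsCompact (closedBall y r) := isCompact_closedBall _ _
    have hpc : Continuous fun w => |p s w - κ| := ((hp2.continuous).sub continuous_const).abs
    have hHeadc : Continuous fun w => |(p s w + lam / 2 * ⟪v s w, v s w⟫_ℝ) - κ| :=
      ((hHead2.continuous).sub continuous_const).abs
    have hpt : ∀ w, |(p s w + lam / 2 * ⟪v s w, v s w⟫_ℝ) - κ| ≤ |p s w - κ| + |lam| / 2 * (C ^ 2 / (-s)) := by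
      intro w
      have e : (p s w + lam / 2 * ⟪v s w, v s w⟫_ℝ) - κ = (p s w - κ) + lam / 2 * ⟪v s w, v s w⟫_ℝ := by ring
      rw [e]
      exact (abs_add_le _ _).trans (by linarith [hqbd w])
    have hvol : volume (closedBall y r) < ⊤ := hcomp.measure_lt_top
    calc ∫ w in closedBall y r, |(p s w + lam / 2 * ⟪v s w, v s w⟫_ℝ) - κ|
        ≤ ∫ w in closedBall y r, (|p s w - κ| + |lam| / 2 * (C ^ 2 / (-s))) := by
          refine setIntegral_mono_on (hHeadc.continuousOn.integrableOn_compact hcomp)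
            ((hpc.continuousOn.integrableOn_compact hcomp).add (integrableOn_const hvol.ne))
            measurableSet_closedBall fun w _ => hpt w
      _ = (∫ w in closedBall y r, |p s w - κ|) + |lam| / 2 * (C ^ 2 / (-s)) * volume.real (closedBall y r) := by
          rw [integral_add (hpc.continuousOn.integrableOn_compact hcomp) (integrableOn_const hvol.ne),
            setIntegral_const, smul_eq_mul, mul_comm (volume.real _)]
      _ ≤ K * (C ^ 2 / (-s)) * volume.real (closedBall y r) +
            |lam| / 2 * (C ^ 2 / (-s)) * volume.real (closedBall y r) := by linarith [hκ]
      _ = M * volume.real (closedBall y r) := by rw [hM]; ring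
  exact fderiv_eq_zero_of_harmonic_of_oscillation hharm y hM0 hosc

/-- **The energy density of a profile with harmonic `Π_λ` is a sub-solution with the drift `(1−λ)v`**:
`∂ₜq + (1−λ)(v·∇)q − Δq = −2|Dv|²_F ≤ 0` at every point of the open slab, `q = |v|²` (two-sided time derivative). -/
theorem energy_subsolution_of_headFamily (hrate : HasTypeITimeDecay C v)
    (hcont : ContinuousOn (uncurry v) (Iio (0 : ℝ) ×ˢ univ))
    (hmild : ∀ s t : ℝ, s < t → t < 0 → ∀ x,
      v t x = UnboundedOperators.heatExtension (v s) (t - s) x - oseenDuhamel 1 s v v t x)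
    (hdiv : ∀ t < 0, VectorCalculus.IsDivFree (v t)) (lam : ℝ)
    (hH : ∀ s < 0, ∀ y : EuclideanSpace ℝ (Fin 3),
      (lam - 1) * LinearMap.trace ℝ (EuclideanSpace ℝ (Fin 3))
          (((fderiv ℝ (v s) y).comp (fderiv ℝ (v s) y)) : EuclideanSpace ℝ (Fin 3) →ₗ[ℝ] EuclideanSpace ℝ (Fin 3)) +
        lam * (⟪v s y, (Δ (v s)) y⟫_ℝ + ‖curl (v s) y‖ ^ 2) = 0)
    {t : ℝ} (ht : t < 0) (x : EuclideanSpace ℝ (Fin 3)) :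
    HasDerivAt (fun τ => ⟪v τ x, v τ x⟫_ℝ) (deriv (fun τ => ⟪v τ x, v τ x⟫_ℝ) t) t ∧
      deriv (fun τ => ⟪v τ x, v τ x⟫_ℝ) t +
          fderiv ℝ (fun y => ⟪v t y, v t y⟫_ℝ) x ((1 - lam) • v t x) -
          (Δ (fun y => ⟪v t y, v t y⟫_ℝ)) x ≤ 0 := by
  have hA : IsTypeIAncientMild C v := isTypeIAncientMild_of_class hrate hcont hmild hdiv
  have ht₀ : t - 1 < 0 := by linarith
  have htI : t ∈ Ioo (t - 1) 0 := ⟨by linarith, ht⟩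
  obtain ⟨p, hcl⟩ := hA.exists_isClassicalNSSolutionOn_Ioo ht₀
  have hbal := energyDensity_balance isOpen_Ioo hcl htI x
  have hv2 : ContDiff ℝ 2 (v t) := contDiff_infty.1 (hcl.contDiff_velocity htI) 2
  have hp2 : ContDiff ℝ 2 (p t) := contDiff_infty.1 (hcl.contDiff_pressure htI) 2
  have hvd : DifferentiableAt ℝ (v t) x := (hv2.differentiable (by norm_num)) x
  have hpd : DifferentiableAt ℝ (p t) x := (hp2.differentiable (by norm_num)) x
  have hqd : DifferentiableAt ℝ (fun y => ⟪v t y, v t y⟫_ℝ) x := hvd.inner ℝ hvd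
  -- `∇Π_λ(t, x) = 0` read along `v(t, x)`: `⟪v, ∇p⟫ = −(λ/2) Dq(v)`
  have hD := fderiv_headFamily_eq_zero hrate hmild lam ht₀ hcl htI (hH t ht) x
  have h1 : fderiv ℝ (fun z => p t z + lam / 2 * ⟪v t z, v t z⟫_ℝ) x (v t x) =
      fderiv ℝ (p t) x (v t x) + lam / 2 * fderiv ℝ (fun z => ⟪v t z, v t z⟫_ℝ) x (v t x) := by
    rw [fderiv_fun_add hpd (hqd.const_mul _), fderiv_const_mul hqd]
    rfl
  rw [hD] at h1
  rw [show (0 : EuclideanSpace ℝ (Fin 3) →L[ℝ] ℝ) (v t x) = 0 from rfl] at h1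
  have h3 : fderiv ℝ (p t) x (v t x) = ⟪v t x, gradient (p t) x⟫_ℝ := by
    rw [gradient, real_inner_comm, InnerProductSpace.toDual_symm_apply]
  rw [h3] at h1
  -- the time derivative within the open window is the two-sided derivative
  have hdu : HasDerivWithinAt (fun τ => v τ x) (timeDerivWithin (Ioo (t - 1) 0) v t x) (Ioo (t - 1) 0) t := by
    rw [timeDerivWithin_apply]
    exact (hcl.smooth_velocity.differentiableWithinAt_time htI x).hasDerivWithinAt
  have hq : HasDerivAt (fun τ => ⟪v τ x, v τ x⟫_ℝ)
      (⟪v t x, timeDerivWithin (Ioo (t - 1) 0) v t x⟫_ℝ +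
        ⟪timeDerivWithin (Ioo (t - 1) 0) v t x, v t x⟫_ℝ) t :=
    (hdu.inner ℝ hdu).hasDerivAt (isOpen_Ioo.mem_nhds htI)
  refine ⟨hq.differentiableAt.hasDerivAt, ?_⟩
  have hderiv : deriv (fun τ => ⟪v τ x, v τ x⟫_ℝ) t =
      timeDerivWithin (Ioo (t - 1) 0) (fun τ y => ⟪v τ y, v τ y⟫_ℝ) t x := by
    rw [timeDerivWithin_apply, derivWithin_of_isOpen isOpen_Ioo htI]
  rw [hderiv, map_smul, smul_eq_mul]
  have hF := frobeniusNormSq_nonneg (fderiv ℝ (v t) x)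
  linarith

/-- **TYPE-I PROFILES WITH HARMONIC `Π_λ` ARE TRIVIAL, for every real `λ`**: the energy density is a bounded
sub-solution with the bounded drift `(1−λ)v` on every slab `[t₀, t₁] × ℝ³`, `t₁ < 0`, so the whole-space maximum
principle gives `|v(t₁,x)|² ≤ C²/(−t₀) → 0` as `t₀ → −∞`. -/
theorem eq_zero_of_headFamily (hrate : HasTypeITimeDecay C v)
    (hcont : ContinuousOn (uncurry v) (Iio (0 : ℝ) ×ˢ univ))
    (hmild : ∀ s t : ℝ, s < t → t < 0 → ∀ x,
      v t x = UnboundedOperators.heatExtension (v s) (t - s) x - oseenDuhamel 1 s v v t x)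
    (hdiv : ∀ t < 0, VectorCalculus.IsDivFree (v t)) (lam : ℝ)
    (hH : ∀ s < 0, ∀ y : EuclideanSpace ℝ (Fin 3),
      (lam - 1) * LinearMap.trace ℝ (EuclideanSpace ℝ (Fin 3))
          (((fderiv ℝ (v s) y).comp (fderiv ℝ (v s) y)) : EuclideanSpace ℝ (Fin 3) →ₗ[ℝ] EuclideanSpace ℝ (Fin 3)) +
        lam * (⟪v s y, (Δ (v s)) y⟫_ℝ + ‖curl (v s) y‖ ^ 2) = 0) :
    ∀ t < 0, ∀ x, v t x = 0 := by
  have hA : IsTypeIAncientMild C v := isTypeIAncientMild_of_class hrate hcont hmild hdiv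
  set q : ℝ → EuclideanSpace ℝ (Fin 3) → ℝ := fun τ y => ⟪v τ y, v τ y⟫_ℝ with hqdef
  set qt : ℝ → EuclideanSpace ℝ (Fin 3) → ℝ := fun τ y => deriv (fun τ' => q τ' y) τ with hqtdef
  have hsm : IsSmoothSpaceTimeOn (Iio 0) v := hA.contDiffOn
  intro t₁ ht₁ x₁
  have hkey : ∀ t₀ < t₁, q t₁ x₁ ≤ C ^ 2 / (-t₀) := by
    intro t₀ ht₀
    -- drift `(1 − λ) v`, bounded on `[t₀, t₁]`
    obtain ⟨B, hB⟩ := bdd_of_hasTypeITimeDecay hrate (-t₁ / 2) (by linarith)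
    have hbA : ∀ t ∈ Icc t₀ t₁, ∀ x, ‖(1 - lam) • v t x‖ ≤ |1 - lam| * B := fun t ht x => by
      rw [norm_smul, Real.norm_eq_abs]
      exact mul_le_mul_of_nonneg_left (hB t (by linarith [ht.2]) x) (abs_nonneg _)
    have hq_c : ContinuousOn (uncurry q) (Icc t₀ t₁ ×ˢ univ) := by
      have hvc : ContinuousOn (uncurry v) (Icc t₀ t₁ ×ˢ univ) :=
        hsm.continuousOn.mono (prod_mono (fun t ht => lt_of_le_of_lt ht.2 ht₁) Subset.rfl)
      have h : ContinuousOn (fun z => ⟪uncurry v z, uncurry v z⟫_ℝ) (Icc t₀ t₁ ×ˢ univ) := hvc.inner hvc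
      refine h.congr fun z _ => ?_
      simp only [hqdef, uncurry]
    have hq2 : ∀ t ∈ Icc t₀ t₁, ContDiff ℝ 2 (q t) := fun t ht => by
      have htn : t < 0 := lt_of_le_of_lt ht.2 ht₁
      have hV : ContDiff ℝ 2 (v t) :=
        (analyticOnNhd_slice hcont (bdd_of_hasTypeITimeDecay hrate) hmild htn).contDiff
      exact hV.inner ℝ hV
    have hsub := fun t (ht : t ∈ Icc t₀ t₁) x =>
      energy_subsolution_of_headFamily hrate hcont hmild hdiv lam hH (lt_of_le_of_lt ht.2 ht₁) x
    have hqt : ∀ x, ∀ t ∈ Icc t₀ t₁, HasDerivAt (fun τ => q τ x) (qt t x) t := fun x t ht => (hsub t ht x).1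
    have hlaw : ∀ t ∈ Icc t₀ t₁, ∀ x, qt t x + fderiv ℝ (q t) x ((1 - lam) • v t x) - (Δ (q t)) x ≤ 0 :=
      fun t ht x => (hsub t ht x).2
    have hqbd : ∀ t < 0, ∀ x, q t x ≤ C ^ 2 / (-t) := fun t ht x => by
      simp only [hqdef, real_inner_self_eq_norm_sq]
      have h1 := hrate t ht x
      have h2 : ‖v t x‖ ^ 2 ≤ (C / Real.sqrt (-t)) ^ 2 := pow_le_pow_left₀ (norm_nonneg _) h1 2
      rw [div_pow, Real.sq_sqrt (by linarith)] at h2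
      exact h2
    have hbdd : ∀ t ∈ Icc t₀ t₁, ∀ x, |q t x| ≤ C ^ 2 / (-t₁) := fun t ht x => by
      have htn : t < 0 := lt_of_le_of_lt ht.2 ht₁
      have hq0 : 0 ≤ q t x := by simp only [hqdef]; exact real_inner_self_nonneg
      rw [abs_of_nonneg hq0]
      exact (hqbd t htn x).trans (div_le_div_of_nonneg_left (sq_nonneg C) (by linarith) (by linarith [ht.2]))
    have hinit : ∀ x, q t₀ x ≤ C ^ 2 / (-t₀) := fun x => hqbd t₀ (ht₀.trans ht₁) x
    exact le_of_bounded_subsolution (b := fun t x => (1 - lam) • v t x) ht₀ hbA hq_c hq2 hqt hlaw hbdd hinit t₁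
      ⟨ht₀.le, le_rfl⟩ x₁
  have hq0 : 0 ≤ q t₁ x₁ := by simp only [hqdef]; exact real_inner_self_nonneg
  have hqle : q t₁ x₁ ≤ 0 := by
    refine le_of_forall_pos_le_add fun η hη => ?_
    set t₀ : ℝ := t₁ - 1 - C ^ 2 / η with ht₀def
    have hq' : 0 ≤ C ^ 2 / η := div_nonneg (sq_nonneg C) hη.le
    have ht₀ : t₀ < t₁ := by rw [ht₀def]; linarith
    have hnt₀ : C ^ 2 / η ≤ -t₀ := by rw [ht₀def]; linarith
    have hpos : 0 < -t₀ := by linarith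
    have h1 : C ^ 2 / (-t₀) ≤ η := by
      rw [div_le_iff₀ hpos]
      calc C ^ 2 = C ^ 2 / η * η := by field_simp
        _ ≤ -t₀ * η := mul_le_mul_of_nonneg_right hnt₀ hη.le
        _ = η * -t₀ := mul_comm _ _
    linarith [hkey t₀ ht₀]
  have hq00 : q t₁ x₁ = 0 := le_antisymm hqle hq0
  simpa only [hqdef, inner_self_eq_zero] using hq00

/-! ### window → slab and the door-crux form -/

/-- **The `Π_λ` source `y ↦ (λ−1) tr((Dv(s))²) + λ(⟪v(s), Δv(s)⟫ + |curl v(s)|²)` of a slice of a profile of the class is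
real-analytic.** -/
theorem analyticOnNhd_headFamilySource_slice (hrate : HasTypeITimeDecay C v)
    (hcont : ContinuousOn (uncurry v) (Iio (0 : ℝ) ×ˢ univ))
    (hmild : ∀ s t : ℝ, s < t → t < 0 → ∀ x,
      v t x = UnboundedOperators.heatExtension (v s) (t - s) x - oseenDuhamel 1 s v v t x)
    (lam : ℝ) {s : ℝ} (hs : s < 0) :
    AnalyticOnNhd ℝ (fun y => (lam - 1) * LinearMap.trace ℝ (EuclideanSpace ℝ (Fin 3))
        (((fderiv ℝ (v s) y).comp (fderiv ℝ (v s) y)) : EuclideanSpace ℝ (Fin 3) →ₗ[ℝ] EuclideanSpace ℝ (Fin 3)) +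
      lam * (⟪v s y, (Δ (v s)) y⟫_ℝ + ‖curl (v s) y‖ ^ 2)) univ := by
  have h1 := analyticOnNhd_traceSq_slice hrate hcont hmild hs
  have h2 := analyticOnNhd_headSource_slice hrate hcont hmild hs
  exact (analyticOnNhd_const.mul h1).add (analyticOnNhd_const.mul h2)

/-- **Window → slab for the `Π_λ` source.** -/
theorem headFamilySourceWindowToSlab (hrate : HasTypeITimeDecay C v)
    (hcont : ContinuousOn (uncurry v) (Iio (0 : ℝ) ×ˢ univ))
    (hmild : ∀ s t : ℝ, s < t → t < 0 → ∀ x,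
      v t x = UnboundedOperators.heatExtension (v s) (t - s) x - oseenDuhamel 1 s v v t x)
    (lam : ℝ)
    (hwin : ∀ s < 0, ∃ U : Set (EuclideanSpace ℝ (Fin 3)), IsOpen U ∧ U.Nonempty ∧ ∀ y ∈ U,
      (lam - 1) * LinearMap.trace ℝ (EuclideanSpace ℝ (Fin 3))
          (((fderiv ℝ (v s) y).comp (fderiv ℝ (v s) y)) : EuclideanSpace ℝ (Fin 3) →ₗ[ℝ] EuclideanSpace ℝ (Fin 3)) +
        lam * (⟪v s y, (Δ (v s)) y⟫_ℝ + ‖curl (v s) y‖ ^ 2) = 0) :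
    ∀ s < 0, ∀ y : EuclideanSpace ℝ (Fin 3),
      (lam - 1) * LinearMap.trace ℝ (EuclideanSpace ℝ (Fin 3))
          (((fderiv ℝ (v s) y).comp (fderiv ℝ (v s) y)) : EuclideanSpace ℝ (Fin 3) →ₗ[ℝ] EuclideanSpace ℝ (Fin 3)) +
        lam * (⟪v s y, (Δ (v s)) y⟫_ℝ + ‖curl (v s) y‖ ^ 2) = 0 := by
  intro s hs
  obtain ⟨U, hU, hne, hal⟩ := hwin s hs
  exact LocalHelicityTubeDoorFrobeniusWindowRigidityWindow.real_eq_zero_spread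
    (analyticOnNhd_headFamilySource_slice hrate hcont hmild lam hs) hU hne hal

/-- **THE PROFILE WINDOW CRUX OF THE `Π_λ`-DOOR, for every real `λ`**: a profile of the family's Type-I class on which
`(λ−1) tr((Dv)²) + λ(⟪v, Δv⟫ + |curl v|²)` — the Laplacian of `p + λ|v|²/2` — vanishes on a nonempty open window of
every slice `s < 0` is not backward-singular at the apex. -/
theorem headFamilyWindowRigidity (lam : ℝ) :
    ∀ (C : ℝ) (v : ℝ → EuclideanSpace ℝ (Fin 3) → EuclideanSpace ℝ (Fin 3)),
      Literature.Analysis.FluidPDE.HasTypeITimeDecay C v →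
      ContinuousOn (Function.uncurry v) (Set.Iio (0 : ℝ) ×ˢ Set.univ) →
      (∀ s t : ℝ, s < t → t < 0 → ∀ x, v t x =
        Literature.Analysis.UnboundedOperators.heatExtension (v s) (t - s) x -
          Literature.Analysis.FluidPDE.oseenDuhamel 1 s v v t x) →
      (∀ t < 0, Literature.Analysis.FluidPDE.VectorCalculus.IsDivFree (v t)) →
      (∀ s < 0, ∃ U : Set (EuclideanSpace ℝ (Fin 3)), IsOpen U ∧ U.Nonempty ∧ ∀ y ∈ U,
        (lam - 1) * LinearMap.trace ℝ (EuclideanSpace ℝ (Fin 3))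
            (((fderiv ℝ (v s) y).comp (fderiv ℝ (v s) y)) :
              EuclideanSpace ℝ (Fin 3) →ₗ[ℝ] EuclideanSpace ℝ (Fin 3)) +
          lam * (⟪v s y, (Δ (v s)) y⟫_ℝ + ‖Literature.Analysis.FluidPDE.curl (v s) y‖ ^ 2) = 0) →
      ¬ Literature.Analysis.FluidPDE.IsBackwardSingularPoint v 0 := by
  intro C v hrate hcont hmild hdiv hwin
  exact not_backwardSingular_of_zero
    (eq_zero_of_headFamily hrate hcont hmild hdiv lam (headFamilySourceWindowToSlab hrate hcont hmild lam hwin))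

end Summit.NavierStokesRegularity.NavierStokesRegularity.Theorems.LocalTraceTubeDoorHeadFamily

end
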